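import Literature.AlgebraicGeometry.Resolution.LogBlowupOrthant
import Literature.Geometry.PolyhedralFans.RegularBasis
import HarnessLib

/-!
# Crux `FrobeniusLadder.FRationalResolution` (stmt-ResolutionOfSingularities-15317), line `redirect`,
# stub `stub_diagonalizableQuotientResolution` — dictionary (ι″): an ORTHANT-LIKE localisation `P + M` exhibits the
# orthogonal face of `P^∨` as a REGULAR face with primitive generators (dual basis vectors)

The adapter between `…PrimaryCentreAtIsolatedPoint.exists_primary_monomialCentre_of_isolated` (hypothesis `hfaces`:
vanishing of the value function on `{v ∈ P^∨ : v ⊥ face}` for ORTHANT-LIKE `P + ℤ·face`) and the fan brick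
`Fan.exists_regular_refinement_isStrictSupport_sparing` (conclusion: vanishing on REGULAR faces `τ = hull T`, `IsPrimGens τ T`,
`IsRegularGens T`, of the face fan of `σ = P^∨`). For `Q = P + M` orthant-like in a `ℤ`-basis `b` with index set `I`
(`x ∈ Q ↔ bᵢ^*(x) ≥ 0 ∀ i ∈ I`), `M` generated by a set `F ⊆ P`: the cone `τ = hull {eᵢ^* : i ∈ I}` of dual basis vectors is
`Q^∨`, is a FACE of `P^∨` with primitive regular generators, and contains every `v ∈ P^∨` orthogonal to `F`.

* `toRat_dualVec_dotProduct_toRat` and friends — pairing bookkeeping;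
* **`exists_regular_face_of_isOrthantLike`** — the dictionary.

Honest label: lattice algebra (no stub closed). No definitions, no named facts, no sorry. [cite: Fulton1993Toric, §1.2, §1.3, §2.1]
-/

-- single-problem summit: the doubled namespace component is forced
set_option linter.dupNamespace false

namespace Summit.ResolutionOfSingularities.ResolutionOfSingularities.Theorems.FRationalResolution.RegularFaceOfOrthantLike

open Literature.Geometry.PolyhedralFans Literature.AlgebraicGeometry.Resolution Literature.AlgebraicGeometry.Resolution.LogBlowup
open Literature.AlgebraicGeometry.Resolution.LogRefinedChart PointedCone
open Literature.Combinatorics.Optimization.HilbertBasis (toRat toRat_add toRat_zero toRat_nsmul toRat_sum toRat_injective)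

variable {n : ℕ}

/-- `toRat u ⬝ᵥ toRat v = ↑(u ⬝ᵥ v)`. [folklore] -/
theorem toRat_dotProduct_toRat (u v : Fin n → ℤ) : toRat u ⬝ᵥ toRat v = ((u ⬝ᵥ v : ℤ) : ℚ) := by
  simp only [dotProduct, toRat]
  push_cast
  rfl

/-- `toRat` of an integer multiple. [folklore] -/
theorem toRat_zsmul (c : ℤ) (x : Fin n → ℤ) : toRat (c • x) = (c : ℚ) • toRat x := by
  funext i; simp [toRat]

/-- `toRat` of a negative. [folklore] -/
theorem toRat_neg (x : Fin n → ℤ) : toRat (-x) = -toRat x := by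
  funext i; simp [toRat]

/-- `toRat` lands in the lattice. [folklore] -/
theorem toRat_mem_latticeN (x : Fin n → ℤ) : toRat x ∈ latticeN (Fin n) :=
  (mem_latticeN_iff).2 fun i => ⟨x i, rfl⟩

/-- A lattice vector is `toRat` of an integral vector. [folklore] -/
theorem exists_eq_toRat_of_mem_latticeN {x : Fin n → ℚ} (hx : x ∈ latticeN (Fin n)) : ∃ u : Fin n → ℤ, x = toRat u := by
  choose u hu using (mem_latticeN_iff).1 hx
  exact ⟨u, funext fun i => hu i⟩

/-- A rational vector is determined by its pairings with (the casts of) a `ℤ`-basis of `ℤⁿ`. [cite: Fulton1993Toric, §1.3] -/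
theorem eq_of_forall_dotProduct_toRat_basis_eq [DecidableEq (Fin n)] (b : Module.Basis (Fin n) ℤ (Fin n → ℤ))
    {v w : Fin n → ℚ} (h : ∀ j, toRat (b j) ⬝ᵥ v = toRat (b j) ⬝ᵥ w) : v = w := by
  have hall : ∀ u : Fin n → ℤ, toRat u ⬝ᵥ v = toRat u ⬝ᵥ w := by
    intro u
    rw [← b.sum_repr u, toRat_sum]
    simp only [sum_dotProduct, toRat_zsmul, smul_dotProduct, h]
  funext k
  have := hall (Pi.single k 1)
  have hs : toRat (Pi.single k (1 : ℤ)) = Pi.single k (1 : ℚ) := by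
    funext i; by_cases hik : i = k <;> simp [toRat, hik]
  rwa [hs, single_dotProduct, single_dotProduct, one_mul, one_mul] at this

/-- Expansion of a rational vector in the casts of the dual basis: `v = Σⱼ ⟨bⱼ, v⟩ eⱼ^*`. [cite: Fulton1993Toric, §1.3] -/
theorem eq_sum_dotProduct_smul_toRat_dualVec (b : Module.Basis (Fin n) ℤ (Fin n → ℤ)) (v : Fin n → ℚ) :
    v = ∑ j, (toRat (b j) ⬝ᵥ v) • toRat (dualVec b j) := by
  classical
  refine eq_of_forall_dotProduct_toRat_basis_eq b fun j => ?_
  rw [dotProduct_sum]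
  simp only [dotProduct_smul, smul_eq_mul, toRat_dotProduct_toRat, dotProduct_comm (b j), dualVec_dotProduct_basis]
  rw [Finset.sum_eq_single j]
  · simp
  · intro i _ hij; simp [Ne.symm hij]
  · intro h; exact absurd (Finset.mem_univ j) h

/-- **(ι″) The orthogonal face of an orthant-like localisation is a regular face on dual basis vectors.** Let `P ⊆ ℤⁿ` be a
submonoid, `F ⊆ P` and `M` the subgroup generated by `F`, and suppose `P + M` is orthant-like in the `ℤ`-basis `b` with
index set `I`. Put `T = {eᵢ^* : i ∈ I}` (casts of dual basis vectors) and `τ = hull T`. Then `IsPrimGens τ T`,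
`IsRegularGens T`, `τ` is a face of `P^∨ = dualCone P`, and every `v ∈ P^∨` orthogonal to `F` lies in `τ`.
[cite: Fulton1993Toric, §1.2 (2), §1.3, §2.1] -/
theorem exists_regular_face_of_isOrthantLike (P : AddSubmonoid (Fin n → ℤ)) (F : Set (Fin n → ℤ)) (hFP : F ⊆ P)
    {b : Module.Basis (Fin n) ℤ (Fin n → ℤ)} {I : Finset (Fin n)}
    (hQ : IsOrthantLike b I (P ⊔ (Submodule.span ℤ F).toAddSubmonoid)) :
    ∃ (τ : PointedCone ℚ (Fin n → ℚ)) (T : Finset (Fin n → ℚ)), IsPrimGens τ T ∧ IsRegularGens T ∧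
      τ.IsFaceOf (dualCone P) ∧ ∀ v ∈ dualCone P, (∀ q ∈ F, toRat q ⬝ᵥ v = 0) → v ∈ τ := by
  classical
  set Q : AddSubmonoid (Fin n → ℤ) := P ⊔ (Submodule.span ℤ F).toAddSubmonoid with hQdef
  have hPQ : P ≤ Q := le_sup_left
  have hMQ : ∀ m ∈ Submodule.span ℤ F, m ∈ Q := fun m hm => (le_sup_right : _ ≤ Q) hm
  let t : Fin n → Fin n → ℚ := fun i => toRat (dualVec b i)
  set T : Finset (Fin n → ℚ) := I.image t with hTdef
  -- pairing of `t i` with integral vectors: the `i`-th coordinate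
  have ht_pair : ∀ (i : Fin n) (x : Fin n → ℤ), toRat x ⬝ᵥ t i = ((b.repr x i : ℤ) : ℚ) := by
    intro i x
    rw [toRat_dotProduct_toRat, dotProduct_comm, dualVec_dotProduct]
  -- `b j ∈ Q`; `-b j ∈ Q` for `j ∉ I`
  have hbQ : ∀ j, b j ∈ Q := fun j => by
    rw [hQ.mem_iff]; intro i _; rw [Module.Basis.repr_self_apply]; split_ifs <;> simp
  have hbQ' : ∀ j, j ∉ I → -b j ∈ Q := fun j hj => by
    rw [hQ.mem_iff]; intro i hi
    rw [map_neg, Finsupp.neg_apply, Module.Basis.repr_self_apply]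
    split_ifs with h
    · subst h; exact absurd hi hj
    · simp
  -- pairing with the span of `F`
  have hspan0 : ∀ w : Fin n → ℚ, (∀ q ∈ F, toRat q ⬝ᵥ w = 0) →
      ∀ m ∈ Submodule.span ℤ F, toRat m ⬝ᵥ w = 0 := by
    intro w hw m hm
    induction hm using Submodule.span_induction with
    | mem q hq => exact hw q hq
    | zero => rw [toRat_zero, zero_dotProduct]
    | add x y _ _ ihx ihy => rw [toRat_add, add_dotProduct, ihx, ihy, add_zero]
    | smul c x _ ih => rw [toRat_zsmul, smul_dotProduct, ih, smul_zero]
  -- the hull of `T` is the dual of `Q`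
  have hhull_of_dual : ∀ v : Fin n → ℚ, (∀ x ∈ Q, 0 ≤ toRat x ⬝ᵥ v) → v ∈ PointedCone.hull ℚ (T : Set (Fin n → ℚ)) := by
    intro v hv
    have hexp := eq_sum_dotProduct_smul_toRat_dualVec b v
    have hc0 : ∀ j, j ∉ I → toRat (b j) ⬝ᵥ v = 0 := by
      intro j hj
      have h1 := hv _ (hbQ j)
      have h2 := hv _ (hbQ' j hj)
      rw [toRat_neg, neg_dotProduct] at h2
      linarith
    rw [hexp, ← Finset.sum_subset (Finset.subset_univ I)
      (fun j _ hj => by rw [hc0 j hj, zero_smul])]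
    refine Submodule.sum_mem _ fun j hj => ?_
    exact smul_mem_of_nonneg (PointedCone.subset_hull (Finset.mem_coe.2 (Finset.mem_image.2 ⟨j, hj, rfl⟩)))
      (hv _ (hbQ j))
  have hdual_of_hull : ∀ v ∈ PointedCone.hull ℚ (T : Set (Fin n → ℚ)), ∀ x ∈ Q, 0 ≤ toRat x ⬝ᵥ v := by
    intro v hv x hx
    refine (forall_mem_hull_dotProduct_nonneg_iff T (toRat x)).2 ?_ v hv
    intro s hs
    obtain ⟨i, hi, rfl⟩ := Finset.mem_image.1 hs
    rw [ht_pair]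
    exact_mod_cast (hQ.mem_iff x).1 hx i hi
  -- orthogonality to `F` and `P^∨` give the dual of `Q`
  have hdual_of_perp : ∀ v ∈ dualCone P, (∀ q ∈ F, toRat q ⬝ᵥ v = 0) → ∀ x ∈ Q, 0 ≤ toRat x ⬝ᵥ v := by
    intro v hv hperp x hx
    obtain ⟨p, hp, m, hm, rfl⟩ := AddSubmonoid.mem_sup.1 hx
    rw [toRat_add, add_dotProduct, hspan0 v hperp m hm, add_zero]
    exact (mem_dualCone_iff P).1 hv p hp
  refine ⟨PointedCone.hull ℚ (T : Set (Fin n → ℚ)), T, ⟨?_, ?_, rfl⟩, ⟨?_, ?_, ?_⟩, ⟨?_, ?_⟩, fun v hv hperp =>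
    hhull_of_dual v (hdual_of_perp v hv hperp)⟩
  · -- primitive generators
    intro s hs
    obtain ⟨i, -, rfl⟩ := Finset.mem_image.1 hs
    refine ⟨toRat_mem_latticeN _, ?_, fun c hc hcN => ?_⟩
    · intro h0
      have := ht_pair i (b i)
      rw [show t i = 0 from h0, dotProduct_zero, Module.Basis.repr_self_apply, if_pos rfl] at this
      norm_num at this
    · obtain ⟨u, hu⟩ := exists_eq_toRat_of_mem_latticeN hcN
      have h1 : toRat (b i) ⬝ᵥ (c • t i) = c := by
        rw [dotProduct_smul, smul_eq_mul, ht_pair, Module.Basis.repr_self_apply, if_pos rfl]; simp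
      rw [hu, toRat_dotProduct_toRat] at h1
      have : (1 : ℤ) ≤ b i ⬝ᵥ u := by
        have h0 : (0 : ℚ) < ((b i ⬝ᵥ u : ℤ) : ℚ) := by rw [h1]; exact hc
        exact_mod_cast h0
      rw [← h1]; exact_mod_cast this
  · -- linear independence
    have hli : LinearIndependent ℚ (fun i : ↥I => t i) := by
      rw [Fintype.linearIndependent_iff]
      intro g hg j
      have := congrArg (fun w => toRat (b j) ⬝ᵥ w) hg
      simp only [dotProduct_sum, dotProduct_smul, smul_eq_mul, ht_pair, Module.Basis.repr_self_apply, dotProduct_zero] at this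
      rw [Finset.sum_eq_single j] at this
      · simpa using this
      · intro i _ hij
        rw [if_neg (fun h => hij (Subtype.ext h.symm))]; simp
      · intro h; exact absurd (Finset.mem_univ j) h
    rw [hTdef, Finset.coe_image]
    have hli' : LinearIndepOn ℚ t (↑I : Set (Fin n)) := hli
    exact hli'.id_image
  · -- generators in the lattice
    intro s hs
    obtain ⟨i, -, rfl⟩ := Finset.mem_image.1 hs
    exact toRat_mem_latticeN _
  · -- linear independence (again)
    rw [hTdef, Finset.coe_image]
    have hli : LinearIndependent ℚ (fun i : ↥I => t i) := by
      rw [Fintype.linearIndependent_iff]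
      intro g hg j
      have := congrArg (fun w => toRat (b j) ⬝ᵥ w) hg
      simp only [dotProduct_sum, dotProduct_smul, smul_eq_mul, ht_pair, Module.Basis.repr_self_apply, dotProduct_zero] at this
      rw [Finset.sum_eq_single j] at this
      · simpa using this
      · intro i _ hij
        rw [if_neg (fun h => hij (Subtype.ext h.symm))]; simp
      · intro h; exact absurd (Finset.mem_univ j) h
    have hli' : LinearIndepOn ℚ t (↑I : Set (Fin n)) := hli
    exact hli'.id_image
  · -- saturation: lattice points of the `ℚ`-span are in the `ℤ`-span
    intro x hxN hxspan
    obtain ⟨u, rfl⟩ := exists_eq_toRat_of_mem_latticeN hxN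
    -- coefficients vanish off `I`
    have hperpT : ∀ j, j ∉ I → ∀ w ∈ Submodule.span ℚ (T : Set (Fin n → ℚ)), toRat (b j) ⬝ᵥ w = 0 := by
      intro j hj w hw
      induction hw using Submodule.span_induction with
      | mem s hs =>
        obtain ⟨i, hi, rfl⟩ := Finset.mem_image.1 hs
        rw [ht_pair, Module.Basis.repr_self_apply, if_neg (fun h => hj (by rw [h]; exact hi))]; simp
      | zero => rw [dotProduct_zero]
      | add x y _ _ ihx ihy => rw [dotProduct_add, ihx, ihy, add_zero]
      | smul c x _ ih => rw [dotProduct_smul, ih, smul_zero]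
    have hexp := eq_sum_dotProduct_smul_toRat_dualVec b (toRat u)
    rw [← Finset.sum_subset (Finset.subset_univ I)
      (fun j _ hj => by rw [hperpT j hj _ hxspan, zero_smul])] at hexp
    rw [hexp]
    refine Submodule.sum_mem _ fun i hi => ?_
    rw [toRat_dotProduct_toRat, Int.cast_smul_eq_zsmul]
    exact Submodule.smul_mem _ _ (Submodule.subset_span (Finset.mem_coe.2 (Finset.mem_image.2 ⟨i, hi, rfl⟩)))
  · -- `τ ≤ P^∨`
    rw [PointedCone.hull, Submodule.span_le]
    intro s hs
    obtain ⟨i, hi, rfl⟩ := Finset.mem_image.1 (Finset.mem_coe.1 hs)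
    rw [SetLike.mem_coe, mem_dualCone_iff]
    intro p hp
    rw [ht_pair]
    exact_mod_cast (hQ.mem_iff p).1 (hPQ hp) i hi
  · -- face property
    intro x y a hx hy ha hmem
    apply hhull_of_dual
    intro z hz
    obtain ⟨p, hp, m, hm, rfl⟩ := AddSubmonoid.mem_sup.1 hz
    have hqx : ∀ q ∈ F, toRat q ⬝ᵥ x = 0 := by
      intro q hq
      have h1 : 0 ≤ toRat q ⬝ᵥ x := (mem_dualCone_iff P).1 hx q (hFP hq)
      have h2 : 0 ≤ toRat q ⬝ᵥ y := (mem_dualCone_iff P).1 hy q (hFP hq)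
      have hnegQ : -q ∈ Q := hMQ _ (Submodule.neg_mem _ (Submodule.subset_span hq))
      have h3 := hdual_of_hull _ hmem (-q) hnegQ
      rw [toRat_neg, neg_dotProduct, dotProduct_add, dotProduct_smul, smul_eq_mul] at h3
      nlinarith
    rw [toRat_add, add_dotProduct, hspan0 x hqx m hm, add_zero]
    exact (mem_dualCone_iff P).1 hx p hp

end Summit.ResolutionOfSingularities.ResolutionOfSingularities.Theorems.FRationalResolution.RegularFaceOfOrthantLike
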